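import Summits.QuantumFields.YangMills.Theorems.BalabanUVNodesN15KingModelFullPropagatorL2LocalRateAdj

/-!
# BalabanUVNodes ∕ N15 — THE KING-MODEL RUNG, CURVED EDITION (PART Π, PACKAGE): THE η-RATES OF THE LOCALISED `L²` ENTRIES `hGλ`, `h∇Gλ`, `hG∇*λ` OF [B9]'s
# (3.46) AT `U ≡ 1` UNDER ONE `(C, δ)` — NE2-TYPE, UNIFORM IN THE SCALE SHIFT `n`, for King's full `A = 0` propagator
# (Track A, DAG node N15 = NE2; FAN-OUT v1.1 §N15 s3 «KING-MODEL RUNG … + the one-line statement of what the curved case adds»)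

HONEST FRAMING.  Count-neutral PACKAGING (cell `pub-ymgap`, seat `pub-ymgap-dag-n15-e` g10; `--supports stmt-QuantumFields-20544 --as helper` = K3⁷
`SpineGivenEndpointR13SepCoPH`, WORDS-143).  TEMPLATE LITERATURE, `A = 0`: C. King's scalar U(1)-Higgs MODEL on finite tori ([King1986] (2.13)–(2.17) p. 653,
Prop. 3.8 (3.71) p. 664, Prop. 3.9 (3.73) p. 665), NOT Bałaban's covariant objects; [Balaban1985BackgroundPropagators] Thm 3.1 (3.46) p. 398 (the `L²` layer).
Parts Π ∕ Π-b ∕ Π-c proved, for the pair «fine run `K + n` levels vs coarse run `K` levels, King's pairing `π`», the rates of the three localised `L²` entries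
separately; THIS FILE packages them under ONE `(C, δ)` — the citable name.  Decided in the MODEL at `U ≡ 1`; an NE2-TYPE statement for a layer `T4EtaRate` does not
type; NOT Bałaban's `G(U)`; NE2⁺ is NOT PRINTED and not proved; NOT a node discharge; nothing continuum ∕ ℝ⁴ ∕ OS ∕ mass-gap ∕ Clay.  0 `sorry`, 0 `def`, standard axioms.
* ★★ **`kingFullProp_B9Thm31_l2_local_rate_at_trivialU`** (`0 ≤ γ < 1`).
WHAT THE CURVED CASE ADDS (one line): the same three rates for `G′(U)` over `Reg335` with the multiscale prefactors — NOT printed ([B9] prints η-uniformity only).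
HONEST SCOPE.  As parts Π–Π-c: `A = 0`, periodic b.c., odd `L ≥ 3`, cubes `2L^e`, `K, n ≥ 1`, `0 < m² ≤ m₀²`, weighted `ℓ²` sums, single-block cut-off ∕ source,
`0 ≤ γ < 1`; the mixed entry `h∇G∇*λ` is NOT included (no global `L²` rate for the mixed pair in the tree); not a discharge.
Locators: [Balaban1985BackgroundPropagators] Thm 3.1 (3.46) p. 398; [King1986] (2.13)–(2.17) p. 653, Prop. 3.8 (3.71) p. 664, Prop. 3.9 (3.73) p. 665.
-/

noncomputable section

namespace Summit.QuantumFields.YangMills.BalabanUVNodes.N15KingModelRung.Curved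

open Real Finset Matrix
open Literature.MathematicalPhysics.QuantumFieldTheory.Balaban1983to89.B5Prop11Plancherel (Tor fine unitVec)
open Literature.MathematicalPhysics.QuantumFieldTheory.King1986 (aK aK_pos)
open Literature.MathematicalPhysics.QuantumFieldTheory.King1986.Torus (fineOp blockOf tdistT tdistT_nonneg)

variable {d : ℕ} (L : ℕ) [NeZero L]

/-- ★★ **THE η-RATES OF THE LOCALISED `L²` ENTRIES OF (3.46) AT `U ≡ 1`, ONE `(C, δ)`** (`0 ≤ γ < 1`): for odd `L ≥ 3`, `a > 0`, `m₀² ≥ 0` there are `C, δ > 0` such that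
for every `K, n ≥ 1` (`N = L^K`, `N′ = L^nL^K`), cube `2L^e`, mass `0 < m² ≤ m₀²`, every cut-off `h` on the η′-lattice (`|h| ≤ H_h`, `supp h ⊂` block `b`) and
source `λ` on the η-lattice (`supp λ ⊂` block `b′`), with the bound `R² := (C·H_h·(L^{−γ∕2})^K·e^{−δ|b−b′|})²·N^{−(d+1)}Σ_yλ(y)²`:
`N′^{−(d+1)}Σ_{x′}(h(x′)·[(A₀′⁻¹(λ∘π))(x′) − (A₀⁻¹λ)(πx′)])² ≤ R²` (entry `hGλ`) ∧ the same for `N′∇′_μ`, `N∇_μ` in front (entry `h∇Gλ`, every `μ`) ∧ the same for the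
adjoint-differentiated sources `∇′*_ν(λ∘π)`, `∇*_νλ` (entry `hG∇*λ`, every `ν`).
[cite: Balaban1985BackgroundPropagators, Thm 3.1 (3.46) p.398 (entries 1–3, shape); King1986, Prop. 3.9 (3.73) p.665, Prop. 3.8 (3.71) p.664, (2.17) p.653] -/
theorem kingFullProp_B9Thm31_l2_local_rate_at_trivialU (hLodd : Odd L) (hL : 2 ≤ L) {a : ℝ} (ha : 0 < a) {m0sq : ℝ} (hm0 : 0 ≤ m0sq)
    {γ : ℝ} (hγ0 : 0 ≤ γ) (hγ1 : γ < 1) :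
    ∃ C δ : ℝ, 0 < C ∧ 0 < δ ∧ ∀ (K : ℕ), 1 ≤ K → ∀ (n : ℕ), 1 ≤ n →
      ∀ (e : ℕ) (M : Fin (d + 1) → ℕ) [∀ μ, NeZero (M μ)], (∀ μ, M μ = 2 * L ^ e) →
      ∀ (msq : ℝ), 0 < msq → msq ≤ m0sq →
      ∀ (lam : Tor (fine (L ^ K) M) → ℝ) (h : Tor (fine (L ^ n * L ^ K) M) → ℝ) (Hh : ℝ) (b b' : Tor M), 0 ≤ Hh →
        (∀ x', |h x'| ≤ Hh) → (∀ x', h x' ≠ 0 → blockOf (L ^ n * L ^ K) M x' = b) → (∀ y, lam y ≠ 0 → blockOf (L ^ K) M y = b') →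
        ((((L ^ n * L ^ K : ℕ) : ℝ) ^ (d + 1))⁻¹ * ∑ x', (h x' *
            (((fineOp (L ^ n * L ^ K) M (aK a L (K + n)) (((L ^ n * L ^ K : ℕ) : ℝ) ^ 2) msq)⁻¹
                *ᵥ (fun y' => lam (underPtN L K n M y'))) x'
              - ((fineOp (L ^ K) M (aK a L K) (((L ^ K : ℕ) : ℝ) ^ 2) msq)⁻¹ *ᵥ lam) (underPtN L K n M x'))) ^ 2
          ≤ (C * Hh * (((L : ℝ) ^ (-(γ / 2))) ^ K) * Real.exp (-(δ * tdistT M b b'))) ^ 2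
              * ((((L ^ K : ℕ) : ℝ) ^ (d + 1))⁻¹ * ∑ y, lam y ^ 2)) ∧
        (∀ μ : Fin (d + 1), (((L ^ n * L ^ K : ℕ) : ℝ) ^ (d + 1))⁻¹ * ∑ x', (h x' *
            (((L ^ n * L ^ K : ℕ) : ℝ) * ((((fineOp (L ^ n * L ^ K) M (aK a L (K + n)) (((L ^ n * L ^ K : ℕ) : ℝ) ^ 2) msq)⁻¹
                *ᵥ (fun y' => lam (underPtN L K n M y'))) (x' + unitVec (fine (L ^ n * L ^ K) M) μ))
              - (((fineOp (L ^ n * L ^ K) M (aK a L (K + n)) (((L ^ n * L ^ K : ℕ) : ℝ) ^ 2) msq)⁻¹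
                *ᵥ (fun y' => lam (underPtN L K n M y'))) x'))
            - ((L ^ K : ℕ) : ℝ) * ((((fineOp (L ^ K) M (aK a L K) (((L ^ K : ℕ) : ℝ) ^ 2) msq)⁻¹ *ᵥ lam)
                (underPtN L K n M x' + unitVec (fine (L ^ K) M) μ))
              - (((fineOp (L ^ K) M (aK a L K) (((L ^ K : ℕ) : ℝ) ^ 2) msq)⁻¹ *ᵥ lam) (underPtN L K n M x'))))) ^ 2
          ≤ (C * Hh * (((L : ℝ) ^ (-(γ / 2))) ^ K) * Real.exp (-(δ * tdistT M b b'))) ^ 2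
              * ((((L ^ K : ℕ) : ℝ) ^ (d + 1))⁻¹ * ∑ y, lam y ^ 2)) ∧
        (∀ ν : Fin (d + 1), (((L ^ n * L ^ K : ℕ) : ℝ) ^ (d + 1))⁻¹ * ∑ x', (h x' *
            (((fineOp (L ^ n * L ^ K) M (aK a L (K + n)) (((L ^ n * L ^ K : ℕ) : ℝ) ^ 2) msq)⁻¹
                *ᵥ (fun z' => ((L ^ n * L ^ K : ℕ) : ℝ) * (lam (underPtN L K n M (z' - unitVec (fine (L ^ n * L ^ K) M) ν))
                  - lam (underPtN L K n M z')))) x'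
              - ((fineOp (L ^ K) M (aK a L K) (((L ^ K : ℕ) : ℝ) ^ 2) msq)⁻¹
                *ᵥ (fun z => ((L ^ K : ℕ) : ℝ) * (lam (z - unitVec (fine (L ^ K) M) ν) - lam z))) (underPtN L K n M x'))) ^ 2
          ≤ (C * Hh * (((L : ℝ) ^ (-(γ / 2))) ^ K) * Real.exp (-(δ * tdistT M b b'))) ^ 2
              * ((((L ^ K : ℕ) : ℝ) ^ (d + 1))⁻¹ * ∑ y, lam y ^ 2)) := by
  obtain ⟨C₀, δ₀, hC₀, hδ₀, H₀⟩ := fullPropOp_l2_local_rate (d := d) L hLodd hL ha hm0 hγ0 hγ1.le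
  obtain ⟨C₁, δ₁, hC₁, hδ₁, H₁⟩ := fullPropDOp_l2_local_rate (d := d) L hLodd hL ha hm0 hγ0 hγ1
  obtain ⟨C₂, δ₂, hC₂, hδ₂, H₂⟩ := fullPropAdjOp_l2_local_rate (d := d) L hLodd hL ha hm0 hγ0 hγ1
  set C : ℝ := max C₀ (max C₁ C₂) with hCdef
  set δ : ℝ := min δ₀ (min δ₁ δ₂) with hδdef
  have hc0 : C₀ ≤ C := le_max_left _ _
  have hc1 : C₁ ≤ C := (le_max_left _ _).trans (le_max_right _ _)
  have hc2 : C₂ ≤ C := (le_max_right _ _).trans (le_max_right _ _)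
  have hd0 : δ ≤ δ₀ := min_le_left _ _
  have hd1 : δ ≤ δ₁ := (min_le_right _ _).trans (min_le_left _ _)
  have hd2 : δ ≤ δ₂ := (min_le_right _ _).trans (min_le_right _ _)
  have hδ : 0 < δ := lt_min hδ₀ (lt_min hδ₁ hδ₂)
  have hC : 0 < C := lt_of_lt_of_le hC₀ hc0
  refine ⟨C, δ, hC, hδ, ?_⟩
  intro K hK n hn e M _ hM msq hmsq hcap lam h Hh b b' hHh hh hsh hsl
  have hD : 0 ≤ tdistT M b b' := tdistT_nonneg M b b'
  have hS : 0 ≤ (((L ^ K : ℕ) : ℝ) ^ (d + 1))⁻¹ * ∑ y, lam y ^ 2 := mul_nonneg (by positivity) (Finset.sum_nonneg fun y _ => sq_nonneg _)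
  have hθK : 0 ≤ ((L : ℝ) ^ (-(γ / 2))) ^ K := pow_nonneg (Real.rpow_nonneg (Nat.cast_nonneg _) _) K
  -- monotonicity of the squared bound in `(C, δ)`
  have hmono : ∀ {Ci δi : ℝ}, 0 ≤ Ci → Ci ≤ C → δ ≤ δi →
      (Ci * Hh * ((L : ℝ) ^ (-(γ / 2))) ^ K * Real.exp (-(δi * tdistT M b b'))) ^ 2 * ((((L ^ K : ℕ) : ℝ) ^ (d + 1))⁻¹ * ∑ y, lam y ^ 2)
        ≤ (C * Hh * ((L : ℝ) ^ (-(γ / 2))) ^ K * Real.exp (-(δ * tdistT M b b'))) ^ 2 * ((((L ^ K : ℕ) : ℝ) ^ (d + 1))⁻¹ * ∑ y, lam y ^ 2) := by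
    intro Ci δi hCi0 hCi hδi
    refine mul_le_mul_of_nonneg_right (pow_le_pow_left₀ (by positivity) ?_ 2) hS
    exact mul_le_mul (mul_le_mul_of_nonneg_right (mul_le_mul_of_nonneg_right hCi hHh) hθK)
      (Real.exp_le_exp.mpr (neg_le_neg (mul_le_mul_of_nonneg_right hδi hD))) (Real.exp_pos _).le (by positivity)
  refine ⟨?_, fun μ => ?_, fun ν => ?_⟩
  · exact (H₀ K hK n hn e M hM msq hmsq hcap lam h Hh b b' hHh hh hsh hsl).trans (hmono hC₀.le hc0 hd0)
  · exact (H₁ K hK n hn e M hM msq hmsq hcap μ lam h Hh b b' hHh hh hsh hsl).trans (hmono hC₁.le hc1 hd1)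
  · exact (H₂ K hK n hn e M hM msq hmsq hcap ν lam h Hh b b' hHh hh hsh hsl).trans (hmono hC₂.le hc2 hd2)

end Summit.QuantumFields.YangMills.BalabanUVNodes.N15KingModelRung.Curved
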